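import Summits.AtomisticToContinuum.Crystallization.Theorems.ChartedZeroExcessLayeredLatticeLiouvilleYCA

/-!
# «WarmCoolCut» part YC (lens-2 g61, 26636) — part 2 of 3 (sequel of `…ChartedZeroExcessLayeredLatticeLiouvilleYCA`)

Split for the 400-line cap by the landing lane (hand-2 g31); the module docstring of part 1 (`…ChartedZeroExcessLayeredLatticeLiouvilleYCA`) describes the whole node.  Same namespace; all FQNs unchanged.
0 sorry; standard axioms.
-/

noncomputable section
open scoped BigOperators Classical
open MeasureTheory Set Metric Filter Topology
open Summit.AtomisticToContinuum.Crystallization.Theorems.ChartedPlanarOrderRigidityDoor (E3 atomsIn VisibleGap PertRegime)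
open Summit.AtomisticToContinuum.Crystallization.Theorems.ChartedPlanarOrderDensityDichotomy (μS IsSep nK nK_nonneg)
open Summit.AtomisticToContinuum.Crystallization.Theorems.ChartedPlanarOrderCleanScaleP (IsCleanP IsDoorSetP)
open Summit.AtomisticToContinuum.Crystallization.Theorems.ChartedPlanarOrderMesoCut (LayeredHom EnvClose)
open Summit.AtomisticToContinuum.Crystallization.Theorems.ChartedPlanarOrderDoorLayered (atomsIn_subset sq_le_finsum_mem PeriodicBulkGapDoor)
open Summit.AtomisticToContinuum.Crystallization.Theorems.ChartedPlanarOrderDoorLayeredOsc (IsTwoShellAffineGood)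

namespace Summit.AtomisticToContinuum.Crystallization.Theorems.ChartedZeroExcessLayeredLatticeLiouville

/-! ### YC-3  The kinematic factorisation of the misfit gain: [ΨCoolᵇ] ⟸ [NoWarmᵇ] ∧ [ΨRealᵇ] -/

/-- ★★ **[NoWarmᵇ] «NoWarmWindowBPG ϑ ϑc aHi Λ θ s» — NO WARM STAR: THE `S`-INTRINSIC MISFIT GAIN `ϑ → ϑc`.**  With the binders of [W_Ψᵇ₁] verbatim: `ϑ`-tame
on `win 9R` ⇒ `ϑc`-tame on `win 8R` (`IsTameOn`: rotation `U` AND registration `g` of each star FREE — part UC's currency at the finer threshold).  Equivalently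
[Tᵇ](ϑ) ⇒ [Tᵇ](ϑc) up to the collar; it is [Tᵇ] `TameWindowBPG ϑc` with [Tᵇ](ϑ)'s conclusion as an extra hypothesis, so the cut [Tᵇ] ⟸ [I_D] ∧ [T_bᵇ] of
part UK at parameter `ϑc` is ONE road (its finite certificate [I_D](ϑc) is then a delicate one: the e⋆-replacement gain of a `ϑc`-warm core is `≍ ϑc²` per
site).  The NON-PERTURBATIVE content of [W_Ψᵇ₁] isolated (γ of CRITIC-LEDGER row 1160 (iii)): tilt-blind, registration-blind, no `Ψ`.  NEW · GSC-priced ·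
UNDECIDED(stated test: census (F0c) «WarmScan», see [ΨCoolᵇ]) · INSTRUMENTABLE · IDEA-NEEDED (pointwise; its sparse form [WSᵇ] is the (M)-currency, YC-5) · WEAKER
than [ΨCoolᵇ](ϑc) (`noWarmWindowBPG_of_psiCool`, PROVED) — at `ϑc = ϑ₁` weaker than [W_Ψᵇ₁] itself; under the bond-isomorphism clause the chart carries `S`'s
own stacking word with equilibrium interlayer data, so the word floor `√ε_w ≈ 10⁻²` of part UC's caveat is NOT an inhabitant at `ϑc = 1/200`.
Why it might fail: the mesoscopic warm lens of [ΨCoolᵇ]; and the threshold bookkeeping — a `ϑc`-tame star needs SOME chart patch within `ϑc`, which for an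
aperiodic equilibrium chart exists only up to the patch-geometry oscillation `osc_H` along the word (take `ϑc ≥ osc_H`; `1/200` leaves room).
Sources: part UC ([T]: Ehrlacher–Ortner–Shapeev 2016; Theil 2006; Flatley–Theil arXiv 1407.0692; E–Ming 2007); part UK ([Tᵇ] cut); part YB; F. John 1972
(small strain, free rotation); CRITIC-LEDGER row 1160 (iii) (γ). [this file, g61] -/
def NoWarmWindowBPG (ϑ ϑc aHi Λ θ s : ℝ) : Prop :=
  ∀ δ : ℝ, 0 < δ → ∀ a : ℝ, 0 < a → ∀ Cg : ℝ, 1 ≤ Cg → ∀ K₀ : ℝ, 0 < K₀ → ∃ η₁ : ℝ, 0 < η₁ ∧ ∃ R₁ : ℝ, 0 < R₁ ∧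
    ∀ S : Set E3, IsDoorSetPG aHi δ S → (∀ q ∈ S, IsTwoShellAffineGood θ S q) →
      ∀ η : ℝ, 0 < η → η ≤ η₁ → ∀ R : ℝ, R₁ ≤ R →
        ∀ (L : E3 ≃L[ℝ] E3) (w : ℤ → E3), IsEquilChart a s Λ L w →
          ∀ Ψ : E3 → E3, IsGlobalReg Cg η R S (LayeredHom (L : E3 →L[ℝ] E3) w) Ψ → IsBondIso S Ψ →
            K₀ ≤ η * nK (atomsIn (μS S) 0 R) →
              IsTameOn ϑ S (LayeredHom (L : E3 →L[ℝ] E3) w) (atomsIn (μS S) 0 (9 * R)) →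
              IsTameOn ϑc S (LayeredHom (L : E3 →L[ℝ] E3) w) (atomsIn (μS S) 0 (8 * R))

/-- ★★ **[ΨRealᵇ] «PsiRealisationBP ϑc ϑ₁ ϑ aHi Λ θ s» — A BOND ISOMORPHISM REALISES EVERY `ϑc`-TAME STAR WITHIN `ϑ₁` AFTER A PROPER ROTATION.**  With the
binders of [W_Ψᵇ₁] verbatim plus `ϑc`-tameness on `win 8R` (free `U, g`): `IsCoherentBy ϑ₁ 2 S Ψ (win 8R)` — the FIXED registration `Ψ` does as well as the
free `g`, up to the loss `ϑ₁ − ϑc`.  (α) of CRITIC-LEDGER row 1160 (iii), and the verdict on it: NOT bookkeeping, but KINEMATIC (no `S`-side energy, no GSC,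
no equilibrium of `S` is expected in the proof; the GSC door is inherited from the binders only).  Two lemmas are owed: (i) CHART PATCH RIGIDITY WITH
ROTATIONS — on the star, `Ψ ∘ g⁻¹` is a contact-isomorphism between two `4`-patches of the equilibrium chart (`g` is injective and fills the chart star:
clean `S`, clean `H`, `12` neighbours each), and two contact-isomorphic `4`-patches of a clean Nash `LayeredHom` (same local Hägg word, read off the
contact graph: cuboctahedral vs anticuboctahedral shells) are congruent by an isometry `G` of `E3` up to `osc_H ≤ ϑ₁ − ϑc` (part UN's `IsStarRigid` is the
translation-only version; the rotation-aware one is new); then `M x := G ∘ U` realises `Ψ` within `ϑc + osc_H`; (ii) ORIENTATION — `G` may be IMPROPER (the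
chart's point group contains `−1` / mirrors), but `x ↦ M x ∈ O(3)` is `C·ϑ₁`-Lipschitz along bonds while `‖P − Q‖ ≥ 2` for `det P = 1`, `det Q = −1`, so `det M`
is constant on the bond-connected set `win 8R ∩ S` (tame windows are bond-connected: a site farther than `2` from the centre has a contact strictly closer to
it), and `= +1` at any site whose registration profile is small, `C·(τ x + ϑ₁) < 2` (there `M x` is within `C·(τ x + ϑ₁)` of `1`; such sites exist since
`⨍τ² ≤ 9Cg·η`).  KINEMATIC · ATTACKABLE·M ·
TRUE-type-expected · WEAKER than [ΨCoolᵇ](ϑ₁) (`psiRealisationBP_of_psiCool`, PROVED: it ignores the `ϑc` hypothesis).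
Why it might fail: only through (i) for APERIODIC equilibrium charts — the congruence defect `osc_H` of same-word `4`-patches (dependence of relaxed interlayer
data on letters `≥ 5` layers away, `≲ 10⁻³` expected) must fit in `ϑ₁ − ϑc` (`= 1/200` at the column literals); for periodic charts `osc_H = 0` and `ϑc = ϑ₁` works.
Sources: part UN ([GΨᵇ] `CoherenceTransferBP`, `IsStarRigid`); part TG (`IsBondIso`); Conway–Sloane SPLAG Ch. 1 (the two 12-contact graphs); part Q
(domination clause); CRITIC-LEDGER row 1160 (iii) (α). [this file, g61] -/
def PsiRealisationBP (ϑc ϑ₁ ϑ aHi Λ θ s : ℝ) : Prop :=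
  ∀ δ : ℝ, 0 < δ → ∀ a : ℝ, 0 < a → ∀ Cg : ℝ, 1 ≤ Cg → ∀ K₀ : ℝ, 0 < K₀ → ∃ η₁ : ℝ, 0 < η₁ ∧ ∃ R₁ : ℝ, 0 < R₁ ∧
    ∀ S : Set E3, IsDoorSetPG aHi δ S → (∀ q ∈ S, IsTwoShellAffineGood θ S q) →
      ∀ η : ℝ, 0 < η → η ≤ η₁ → ∀ R : ℝ, R₁ ≤ R →
        ∀ (L : E3 ≃L[ℝ] E3) (w : ℤ → E3), IsEquilChart a s Λ L w →
          ∀ Ψ : E3 → E3, IsGlobalReg Cg η R S (LayeredHom (L : E3 →L[ℝ] E3) w) Ψ → IsBondIso S Ψ →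
            K₀ ≤ η * nK (atomsIn (μS S) 0 R) →
              IsTameOn ϑ S (LayeredHom (L : E3 →L[ℝ] E3) w) (atomsIn (μS S) 0 (9 * R)) →
              IsTameOn ϑc S (LayeredHom (L : E3 →L[ℝ] E3) w) (atomsIn (μS S) 0 (8 * R)) →
              IsCoherentBy ϑ₁ 2 S Ψ (atomsIn (μS S) 0 (8 * R))

/-- ★★ **GLUE (PROVED): [NoWarmᵇ](ϑ, ϑc) ∧ [ΨRealᵇ](ϑc, ϑ₁, ϑ) ⇒ [ΨCoolᵇ](ϑ₁, ϑ)**. [this file, g61] -/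
theorem psiCoolWindowBPG_of_noWarm_real {ϑc ϑ₁ ϑ aHi Λ θ s : ℝ} (hN : NoWarmWindowBPG ϑ ϑc aHi Λ θ s)
    (hP : PsiRealisationBP ϑc ϑ₁ ϑ aHi Λ θ s) : PsiCoolWindowBPG ϑ₁ ϑ aHi Λ θ s := by
  intro δ hδ a ha Cg hCg K₀ hK₀
  obtain ⟨η₂, hη₂, R₂, hR₂, h2⟩ := hN δ hδ a ha Cg hCg K₀ hK₀
  obtain ⟨η₃, hη₃, R₃, hR₃, h3⟩ := hP δ hδ a ha Cg hCg K₀ hK₀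
  refine ⟨min η₂ η₃, lt_min hη₂ hη₃, max R₂ R₃, lt_max_of_lt_left hR₂, ?_⟩
  intro S hS hgood η hη hηle R hR L w hLw Ψ hΨ hBI hfat htame
  have hcool := h2 S hS hgood η hη (hηle.trans (min_le_left _ _)) R ((le_max_left _ _).trans hR) L w hLw Ψ hΨ hBI hfat htame
  exact h3 S hS hgood η hη (hηle.trans (min_le_right _ _)) R ((le_max_right _ _).trans hR) L w hLw Ψ hΨ hBI hfat htame hcool

/-- **[ΨCoolᵇ](ϑc) ⇒ [NoWarmᵇ](ϑ, ϑc) (PROVED)** — Ψ-coolness at `ϑc` is `ϑc`-tameness with `g := Ψ` (the weaker-than certificate of the amplitude piece: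
at `ϑc = ϑ₁` it sits below [ΨCoolᵇ](ϑ₁), hence below [W_Ψᵇ₁]). [this file, g61] -/
theorem noWarmWindowBPG_of_psiCool {ϑ ϑc aHi Λ θ s : ℝ} (h : PsiCoolWindowBPG ϑc ϑ aHi Λ θ s) : NoWarmWindowBPG ϑ ϑc aHi Λ θ s := by
  intro δ hδ a ha Cg hCg K₀ hK₀
  obtain ⟨η₁, hη₁, R₁, hR₁, h1⟩ := h δ hδ a ha Cg hCg K₀ hK₀
  exact ⟨η₁, hη₁, R₁, hR₁, fun S hS hgood η hη hηle R hR L w hLw Ψ hΨ hBI hfat htame =>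
    (h1 S hS hgood η hη hηle R hR L w hLw Ψ hΨ hBI hfat htame).isTameOn_of_le hΨ.1.mapsTo le_rfl⟩

/-- **[Tᵇ](ϑc) ⇒ [NoWarmᵇ](ϑ, ϑc) (PROVED)** — the [T]-line at the finer parameter `ϑc` (part UK's cut `[Tᵇ] ⟸ [I_D] ∧ [T_bᵇ]` read at `ϑc`) is ONE
road to the misfit gain; [NoWarmᵇ] additionally holds the coarse tameness as a hypothesis. [this file, g61] -/
theorem noWarmWindowBPG_of_tameWindowBPG {ϑ ϑc aHi Λ θ s : ℝ} (h : TameWindowBPG ϑc aHi Λ θ s) : NoWarmWindowBPG ϑ ϑc aHi Λ θ s := by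
  intro δ hδ a ha Cg hCg K₀ hK₀
  obtain ⟨η₁, hη₁, R₁, hR₁, h1⟩ := h δ hδ a ha Cg hCg K₀ hK₀
  exact ⟨η₁, hη₁, R₁, hR₁, fun S hS hgood η hη hηle R hR L w hLw Ψ hΨ hBI hfat _ =>
    (h1 S hS hgood η hη hηle R hR L w hLw Ψ hΨ hBI hfat).mono le_rfl (atomsIn_mono_mul (by norm_num : (8 : ℝ) ≤ 9) (hR₁.le.trans hR))⟩

/-- **[ΨCoolᵇ](ϑ₁) ⇒ [ΨRealᵇ](ϑc, ϑ₁, ϑ) (PROVED)** — the realisation piece is weaker than the misfit-gain piece (it has one more hypothesis). [this file, g61] -/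
theorem psiRealisationBP_of_psiCool {ϑc ϑ₁ ϑ aHi Λ θ s : ℝ} (h : PsiCoolWindowBPG ϑ₁ ϑ aHi Λ θ s) : PsiRealisationBP ϑc ϑ₁ ϑ aHi Λ θ s := by
  intro δ hδ a ha Cg hCg K₀ hK₀
  obtain ⟨η₁, hη₁, R₁, hR₁, h1⟩ := h δ hδ a ha Cg hCg K₀ hK₀
  exact ⟨η₁, hη₁, R₁, hR₁, fun S hS hgood η hη hηle R hR L w hLw Ψ hΨ hBI hfat htame _ =>
    h1 S hS hgood η hη hηle R hR L w hLw Ψ hΨ hBI hfat htame⟩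

/-! ### YC-4  The seam (R_Wᵇ) ⟸ [Tᵇ] ∧ [W_Ψᵇ₁|c] and the columns `_16XH22B`, `_16XH22B₂` -/

/-- ★★ **(R_Wᵇ) ⟸ [Tᵇ] ∧ [W_Ψᵇ₁|c] for every `c ≥ 1` under the side condition `4·ω₁ + ϑ₁ < tameRadius`** (`Ψ' := Ψ`, `Cg' := Cg`): coherence on
`win (c·R) ⊇ win R` kills every `tameRadius`-wild bond of `win R` (part YB `wildMass_eq_zero_of_isCoherentBy`). [this file, g61] -/
theorem wildFractionBPG_of_tame_coherentAt {c ϑ₁ ω₁ ϑ aHi Λ θ s : ℝ} (hc : 1 ≤ c) (hside : 4 * ω₁ + ϑ₁ < tameRadius)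
    (hT : TameWindowBPG ϑ aHi Λ θ s) (hW : CoherentWindowPsiBPGAt c ϑ₁ ω₁ ϑ aHi Λ θ s) : WildFractionBPG aHi Λ θ s := by
  intro δ hδ a ha Cg hCg
  refine ⟨Cg, le_rfl, fun εw hεw K₀ hK₀ => ?_⟩
  obtain ⟨η₂, hη₂, R₂, hR₂, h2⟩ := hT δ hδ a ha Cg hCg K₀ hK₀
  obtain ⟨η₃, hη₃, R₃, hR₃, h3⟩ := hW δ hδ a ha Cg hCg K₀ hK₀
  refine ⟨min η₂ η₃, lt_min hη₂ hη₃, max R₂ R₃, lt_max_of_lt_left hR₂, ?_⟩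
  intro S hS hgood η hη hηle R hR L w hLw Ψ hΨ hBI hfat
  have hR2 : R₂ ≤ R := (le_max_left _ _).trans hR
  have hR3 : R₃ ≤ R := (le_max_right _ _).trans hR
  have htame := h2 S hS hgood η hη (hηle.trans (min_le_left _ _)) R hR2 L w hLw Ψ hΨ hBI hfat
  have hcoh := h3 S hS hgood η hη (hηle.trans (min_le_right _ _)) R hR3 L w hLw Ψ hΨ hBI hfat htame
  have hR0 : 0 ≤ R := hR₂.le.trans hR2
  have hsub : atomsIn (μS S) 0 R ⊆ atomsIn (μS S) 0 (c * R) := by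
    have h := atomsIn_mono_mul (S := S) hc hR0
    rwa [one_mul] at h
  refine ⟨Ψ, hΨ, ?_⟩
  rw [wildMass_eq_zero_of_isCoherentBy hcoh hsub (fun _ hx => (mem_atomsIn_iff.1 hx).1) hside]
  exact mul_nonneg (mul_nonneg hεw.le hη.le) (nK_nonneg _)

/-- **(R_Wᵇ) ⟸ [I_D] ∧ [T_bᵇ] ∧ [ΨCoolᵇ] ∧ [CoolLockedᵇ]** under the side condition (parts UK, YB; this file's glue at `c = 7`). [this file, g61] -/
theorem wildFractionBPG_of_dressedCore_cool_locked {ϑ₁ ω₁ ϑ ϑe ωe : ℝ} {p : ℕ} {r₀ ℓ : ℝ} {M : ℕ} {aHi Λ θ s : ℝ} (hside : 4 * ω₁ + ϑ₁ < tameRadius)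
    (hI : DressedCorePG ϑ ϑe ωe p r₀ ℓ M aHi Λ θ s) (hTb : BareTameWindowBPG ϑ ϑe ωe p r₀ ℓ M aHi Λ θ s)
    (hC : PsiCoolWindowBPG ϑ₁ ϑ aHi Λ θ s) (hL : CoolLockedWindowBPG ϑ₁ ω₁ ϑ aHi Λ θ s) : WildFractionBPG aHi Λ θ s :=
  wildFractionBPG_of_tame_coherentAt (by norm_num) hside (tameWindowBPG_of_dressedCore_of_bare hI hTb)
    (coherentWindowPsiBPGAt_seven_of_cool_locked hC hL)

/-- ★★★ **COLUMN `_16XH22B`** — `_16XH21B₁` (part YB) with the residual [W_Ψᵇ₁](1/100, 1/200) CUT INTO ITS TWO HALVES: the misfit gain [ΨCoolᵇ](1/100)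
(non-perturbative, tilt-blind) and the orientation locking [CoolLockedᵇ](1/100, 1/200) (perturbative, inside the cool basin).  RESIDUAL DOCKET: the twenty
generic leaves + {[I_D], [T_bᵇ], [ΨCoolᵇ], [CoolLockedᵇ]} + `PeriodicBulkGapDoor 2`; recovered from `_16XH21B₁`'s docket by `psiCool_and_coolLocked_of_coherent₁`.
[this file, g61] -/
theorem gap_and_pert_1_50_of_certs_16XH22B (hL : LatticeLiouvilleCert) (hL' : LayeredLiouvilleCert)
    (hR : OscRigidityL2BDPG 1 2 (1 / 16) (1 / 16)) (hX : ExcessFlatnessControlP 1 2 (1 / 16) (1 / 16))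
    (hE : ExcessChartLocalisationP 1 2 (1 / 16) (1 / 100)) (hP : RegistrationP 1 2 (1 / 16) (1 / 100))
    (hT : TailDominationCert) (hU : UniformTameStabilityE (1 / 50) 2 (1 / 2000))
    (h1 : WordTransplantP 1 2 (1 / 16) (1 / 100)) (hGT : GradReframingThickP 1 2 (1 / 16) (1 / 100) (1 / 50))
    (hΛ0 : LaunderingAprioriPX 1 2 (1 / 16) (1 / 100) (1 / 50)) (hΛs : LaunderingStepPX 1 2 (1 / 16) (1 / 100) (1 / 50))
    (hUc : UntwistCollarP 1 2 (1 / 16) (1 / 50))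
    (hl : BondIsoLevelsP 1 2 (1 / 16) (1 / 50)) (hN : EnergyNearChartPX 1 2 (1 / 16) (1 / 50) (1 / 2000))
    (hF : TailForceSlavingP 1 2 (1 / 16) (1 / 50))
    (hE' : LipDualLinearisationP 1 2 (1 / 16) (1 / 50)) (hA : L2HarmonicApproxPE 1 2 (1 / 16) (1 / 50) (1 / 2000))
    (hD : PositionDecayPLE 1 2 (1 / 16) (1 / 50) (1 / 2000)) (hC : PositionCaccioppoliPGE 1 2 (1 / 16) (1 / 50) (1 / 2000))
    (hI : DressedCorePG tameRadius dressLevel dressLevel dressExponent 8 collarRadius clusterSize 1 2 (1 / 16) (1 / 50))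
    (hTb : BareTameWindowBPG tameRadius dressLevel dressLevel dressExponent 8 collarRadius clusterSize 1 2 (1 / 16) (1 / 50))
    (hΨC : PsiCoolWindowBPG (1 / 100) tameRadius 1 2 (1 / 16) (1 / 50))
    (hCL : CoolLockedWindowBPG (1 / 100) (1 / 200) tameRadius 1 2 (1 / 16) (1 / 50))
    (hG : PeriodicBulkGapDoor 2) : VisibleGap (1 / 50) ∧ PertRegime (1 / 50) :=
  gap_and_pert_1_50_of_certs_16XH18B_tol hL hL' hR hX hE hP hT hU h1 hGT hΛ0 hΛs hUc (untwistBookkeepingP_one 2 (1 / 50)) hl hN hF hE' hA hD hC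
    (wildFractionBPG_of_dressedCore_cool_locked (by norm_num [tameRadius]) hI hTb hΨC hCL) hG

/-- ★★★ **COLUMN `_16XH22B₂`** — `_16XH22B` with the misfit gain FACTORISED at the cool threshold `ϑc = 1/200`: [NoWarmᵇ](1/20 → 1/200) (the `S`-intrinsic
warm band) ∧ [ΨRealᵇ](1/200 → 1/100) (kinematic: chart patch rigidity with rotations + orientation propagation, room `1/200` for `osc_H`) ∧ [CoolLockedᵇ].
[this file, g61] -/
theorem gap_and_pert_1_50_of_certs_16XH22B₂ (hL : LatticeLiouvilleCert) (hL' : LayeredLiouvilleCert)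
    (hR : OscRigidityL2BDPG 1 2 (1 / 16) (1 / 16)) (hX : ExcessFlatnessControlP 1 2 (1 / 16) (1 / 16))
    (hE : ExcessChartLocalisationP 1 2 (1 / 16) (1 / 100)) (hP : RegistrationP 1 2 (1 / 16) (1 / 100))
    (hT : TailDominationCert) (hU : UniformTameStabilityE (1 / 50) 2 (1 / 2000))
    (h1 : WordTransplantP 1 2 (1 / 16) (1 / 100)) (hGT : GradReframingThickP 1 2 (1 / 16) (1 / 100) (1 / 50))
    (hΛ0 : LaunderingAprioriPX 1 2 (1 / 16) (1 / 100) (1 / 50)) (hΛs : LaunderingStepPX 1 2 (1 / 16) (1 / 100) (1 / 50))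
    (hUc : UntwistCollarP 1 2 (1 / 16) (1 / 50))
    (hl : BondIsoLevelsP 1 2 (1 / 16) (1 / 50)) (hN : EnergyNearChartPX 1 2 (1 / 16) (1 / 50) (1 / 2000))
    (hF : TailForceSlavingP 1 2 (1 / 16) (1 / 50))
    (hE' : LipDualLinearisationP 1 2 (1 / 16) (1 / 50)) (hA : L2HarmonicApproxPE 1 2 (1 / 16) (1 / 50) (1 / 2000))
    (hD : PositionDecayPLE 1 2 (1 / 16) (1 / 50) (1 / 2000)) (hC : PositionCaccioppoliPGE 1 2 (1 / 16) (1 / 50) (1 / 2000))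
    (hI : DressedCorePG tameRadius dressLevel dressLevel dressExponent 8 collarRadius clusterSize 1 2 (1 / 16) (1 / 50))
    (hTb : BareTameWindowBPG tameRadius dressLevel dressLevel dressExponent 8 collarRadius clusterSize 1 2 (1 / 16) (1 / 50))
    (hNW : NoWarmWindowBPG tameRadius (1 / 200) 1 2 (1 / 16) (1 / 50))
    (hΨR : PsiRealisationBP (1 / 200) (1 / 100) tameRadius 1 2 (1 / 16) (1 / 50))
    (hCL : CoolLockedWindowBPG (1 / 100) (1 / 200) tameRadius 1 2 (1 / 16) (1 / 50))
    (hG : PeriodicBulkGapDoor 2) : VisibleGap (1 / 50) ∧ PertRegime (1 / 50) :=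
  gap_and_pert_1_50_of_certs_16XH22B hL hL' hR hX hE hP hT hU h1 hGT hΛ0 hΛs hUc hl hN hF hE' hA hD hC hI hTb
    (psiCoolWindowBPG_of_noWarm_real hNW hΨR) hCL hG

end Summit.AtomisticToContinuum.Crystallization.Theorems.ChartedZeroExcessLayeredLatticeLiouville

end
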